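import Literature.Computability.ImplicitComplexity.STAWeighted
import HarnessLib

/-!
# GMR08 Property 1: derivations of modal types end in a soft promotion

Support file for the `PTIME` soundness half of `STACapturesP` (GMR08 Thm. 3.5). GMR08
Property 1 (= GR07 Lemma 3.4): "`Π ▹ Γ ⊢ M : !σ` implies `Π` can be transformed (commuting some
rules) in a derivation of the shape `(sp)` [over `Π' ▹ Γ' ⊢ M : σ`] followed by rules `(w)` and
`(m)` working on variables not occurring in `M`". Equivalently — and this is the form the
substitution lemma consumes — a derivation of a modal type `!^{k+1} A` contains a derivation of
`!^k A` for the same subject, in a context `Γ'` whose promotion `!Γ'` is INCLUDED in `Γ`, with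
degree one less and weight divided by the rank parameter `r` (the trailing weakenings and
multiplexors do not change the weight, GMR08 Def. A.1, and "the transformation … never increases
the measures of a derivation", GMR08 §3.1).

* `MTyping.property1` — if `MTyping r w d Γ M ⟨k+1, A⟩` then there are `Γ'`, `d'`, `w'` with
  `d = d' + 1`, `w = r * w'`, `MTyping r w' d' Γ' M ⟨k, A⟩` and `Γ i = !(Γ' i)` on the support
  of `Γ'`.

The proof is the rule commutation of GR07: a multiplexor below the promotion is performed above
it instead (on the not-yet-promoted copies), weakenings are dropped.

## References

* [GaboardiMarionRonchidellarocca2008] GMR08, Property 1 (§3), §3.1, Def. A.1.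
* [GaboardiRonchiDellaRocca2007] GR07, Lemma 3.4.
-/

namespace Literature.Computability.ImplicitComplexity

namespace STA

/-- `!` is injective on soft types. [folklore] -/
theorem SoftTy.bang_injective : Function.Injective SoftTy.bang := by
  rintro ⟨k₁, A₁⟩ ⟨k₂, A₂⟩ h
  simp only [SoftTy.bang, SoftTy.mk.injEq, Nat.add_right_cancel_iff] at h
  obtain ⟨rfl, rfl⟩ := h
  rfl

namespace MTyping

variable {r d w : ℕ} {Γ : Ctx} {M : Term}

/-- **GMR08 Property 1 (GR07 Lemma 3.4), weighted de Bruijn form.** A derivation of a modal type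
`Γ ⊢ M : !^{k+1} A` with degree `d`, ranks `≤ r` and weight `w` contains — after commuting the
trailing multiplexors above the last soft promotion and dropping the trailing weakenings — a
derivation of `Γ' ⊢ M : !^k A` with degree `d - 1` and weight `w / r` (exactly: `d = d' + 1`,
`w = r * w'`), where `!Γ'` is included in `Γ` (`Γ i = !(Γ' i)` on the support of `Γ'`).
[cite: GaboardiMarionRonchidellarocca2008, Property 1 and §3.1] -/
theorem property1 {k : ℕ} {A : LinTy} (h : MTyping r w d Γ M ⟨k + 1, A⟩) :
    ∃ Γ' : Ctx, ∃ d' w' : ℕ, d = d' + 1 ∧ w = r * w' ∧ MTyping r w' d' Γ' M ⟨k, A⟩ ∧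
      ∀ i, Γ' i ≠ none → Γ i = (Γ' i).map SoftTy.bang := by
  generalize hτ : (⟨k + 1, A⟩ : SoftTy) = τ at h
  induction h generalizing k A with
  | ax h => cases hτ
  | @weak d w Γ₀ Γ M τ j A₀ h₀ hj hΓ ih =>
    obtain ⟨Γ', d', w', hd, hw, h', hle⟩ := ih hτ
    refine ⟨Γ', d', w', hd, hw, h', fun i hi => ?_⟩
    have hij : i ≠ j := by
      rintro rfl
      have := hle i hi
      rw [hj] at this
      exact hi (by
        cases hΓ'i : Γ' i with
        | none => rfl
        | some σ => rw [hΓ'i] at this; cases this)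
    rw [hΓ, Function.update_of_ne hij]
    exact hle i hi
  | lam _ _ => cases hτ
  | app _ _ _ _ _ => cases hτ
  | @mpx d w Γ₀ Γ M₀ M μ σ S j h₀ hS hj hr hΓ hM ih =>
    obtain ⟨Γ₀', d', w', hd, hw, h₀', hle⟩ := ih hτ
    have hjS : j ∉ S := fun hjS => by rw [hS j hjS] at hj; exact Option.some_ne_none _ hj
    have hj' : Γ₀' j = none := by
      by_contra hne
      have := hle j hne
      rw [hj] at this
      cases hΓj : Γ₀' j with
      | none => exact hne hΓj
      | some σ' => rw [hΓj] at this; cases this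
    -- the contracted slots that are actually used below the promotion
    set S₀ := S.filter (fun i => (Γ₀' i).isSome) with hS₀
    have hS₀sub : S₀ ⊆ S := Finset.filter_subset _ _
    have hmemS₀ : ∀ i, i ∈ S₀ ↔ i ∈ S ∧ Γ₀' i ≠ none := fun i => by
      simp [hS₀, Finset.mem_filter, Option.isSome_iff_ne_none]
    by_cases hex : ∃ i ∈ S, Γ₀' i ≠ none
    · -- some contracted variable occurs: contract the occurring copies below the promotion
      obtain ⟨i₀, hi₀S, hi₀⟩ := hex
      obtain ⟨σ₀, hσ₀⟩ : ∃ σ₀, Γ₀' i₀ = some σ₀ := Option.ne_none_iff_exists'.1 hi₀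
      have hσ : σ = σ₀.bang := by
        have := hle i₀ hi₀
        rw [hS i₀ hi₀S, hσ₀] at this
        simpa using this
      have hS₀ty : ∀ i ∈ S₀, Γ₀' i = some σ₀ := by
        intro i hi
        obtain ⟨hiS, hine⟩ := (hmemS₀ i).1 hi
        obtain ⟨σᵢ, hσᵢ⟩ : ∃ σᵢ, Γ₀' i = some σᵢ := Option.ne_none_iff_exists'.1 hine
        have := hle i hine
        rw [hS i hiS, hσᵢ, hσ] at this
        simp only [Option.map_some, Option.some.injEq] at this
        rw [hσᵢ, SoftTy.bang_injective this.symm]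
      have hcard : S₀.card ≤ r := (Finset.card_le_card hS₀sub).trans hr
      have hjS₀ : j ∉ S₀ := fun h => hjS (hS₀sub h)
      refine ⟨Γ₀'.mpx S₀ j σ₀, d', w', hd, hw,
        MTyping.mpx S₀ j h₀' hS₀ty hj' hcard rfl ?_, fun i hi => ?_⟩
      · rw [hM]
        refine Term.rename_congr_freeIn M₀ fun i hfi => ?_
        have hine : Γ₀' i ≠ none := h₀'.isSome_of_freeIn hfi
        by_cases hiS : i ∈ S
        · have : i ∈ S₀ := (hmemS₀ i).2 ⟨hiS, hine⟩
          simp [mpxRen, hiS, this]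
        · have : i ∉ S₀ := fun h => hiS (hS₀sub h)
          simp [mpxRen, hiS, this]
      · by_cases h1 : i ∈ S₀
        · simp [Ctx.mpx, h1] at hi
        · by_cases h2 : i = j
          · subst h2
            rw [hΓ]
            simp [Ctx.mpx, hjS, hjS₀, hσ]
          · have hi' : Γ₀' i ≠ none := by simpa [Ctx.mpx, h1, h2] using hi
            have hiS : i ∉ S := fun hiS => h1 ((hmemS₀ i).2 ⟨hiS, hi'⟩)
            rw [hΓ]
            simp only [Ctx.mpx, hiS, if_false, h2, h1]
            exact hle i hi'
    · -- no contracted variable occurs: the multiplexor is a weakening, drop it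
      have hempty : ∀ i ∈ S, Γ₀' i = none := fun i hi => by
        by_contra hne
        exact hex ⟨i, hi, hne⟩
      refine ⟨Γ₀', d', w', hd, hw, ?_, fun i hi => ?_⟩
      · have hMM : M = M₀ := by
          rw [hM]
          exact Term.rename_eq_self_of_freeIn M₀ fun i hfi => by
            have : i ∉ S := fun hiS => h₀'.isSome_of_freeIn hfi (hempty i hiS)
            simp [mpxRen, this]
        rw [hMM]
        exact h₀'
      · have hiS : i ∉ S := fun hiS => hi (hempty i hiS)
        have hij : i ≠ j := by rintro rfl; exact hi hj'
        rw [hΓ]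
        simp only [Ctx.mpx, hiS, if_false, hij]
        exact hle i hi
  | @sp d w Γ₀ Γ M k₀ A₀ h₀ hΓ ih =>
    simp only [SoftTy.mk.injEq, Nat.add_right_cancel_iff] at hτ
    obtain ⟨rfl, rfl⟩ := hτ
    exact ⟨Γ₀, d, w, rfl, rfl, h₀, fun i _ => by rw [hΓ]; rfl⟩
  | allI _ _ _ => cases hτ
  | allE _ _ _ => cases hτ

end MTyping

end STA

end Literature.Computability.ImplicitComplexity
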